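import Summits.QuantumAdvantage.QuantumAdvantage.Theorems.SosSandwichPseudoBoundedAAExponentCornerReal
import Summits.QuantumAdvantage.QuantumAdvantage.Theorems.SosSandwichHomogeneousPBAATAveraging

/-!
# Route `SosSandwich`, crux `PseudoBoundedAA` (stmt-QuantumAdvantage-15237) — the admissible exponent corner of
`K` is `(2, 2)` for REAL exponents

Helper (`--supports stmt-QuantumAdvantage-15237`), conjecture-free, no named facts. Real-exponent form of
`pseudoBounded_exponent_corner` (`SosSandwichPseudoBoundedAAExponentCorner.lean`, natural exponents): for
`a ≥ 0` and `b` real, if some `C > 0` makes `Infᵢ[p] ≥ C·Var[p]^a/T^b` (real powers) hold for a variable of every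
pseudo-bounded `p` of order `T ≥ 1` with `Var[p] > 0`, then `a ≥ 2` AND `b ≥ 2`
(`pseudoBounded_exponent_corner_rpow`).
* `a ≥ 2`: the disjointly averaged address family of `SosSandwichHomogeneousPBAATAveraging.lean`
  (`exists_averagedAddress 0 j`: order `2`, `Var = x := (1/4)/2^j → 0`, every influence `= 8x²`), so a law with
  `a < 2` would give `C/(8·2^b) ≤ x^{2−a} → 0`.
* `b ≥ 2`: the Chebyshev / amplitude-amplification family (`chebyshev_calibration`: order `T = 12r`,
  `Var ≥ 1/2592`, every influence `≤ 29/T²`), as in `not_influence_law_subquadratic_in_T`.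
Hence `maxInf ≥ C·Var²/T²` is the unique strongest candidate law on `K` among ALL real exponent pairs. Honest
label: calibration. [folklore] [cite: BealsEtAl2001, §4] [cite: EscuderoGutierrez2023, Conj. 1.5]
-/

set_option linter.dupNamespace false

noncomputable section

namespace Summit.QuantumAdvantage.QuantumAdvantage.Theorems.SosSandwich

open Finset
open Literature.Computability.QuantumComplexity

/-- **Admissible exponent corner on `K`, real exponents: `a ≥ 2 ∧ b ≥ 2`.** [folklore] -/
theorem pseudoBounded_exponent_corner_rpow {a b C : ℝ} (ha : 0 ≤ a) (hC : 0 < C)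
    (h : ∀ (N T : ℕ) (p : MvPolynomial (Fin N) ℝ), 1 ≤ T → PseudoBounded T p → 0 < boolVariance p →
      ∃ i : Fin N, C * boolVariance p ^ a / (T : ℝ) ^ b ≤ influence i p) :
    2 ≤ a ∧ 2 ≤ b := by
  constructor
  · -- `a ≥ 2`: the averaged address family at the fixed order `T = 2`
    by_contra hlt
    push Not at hlt
    have he : 0 < 2 - a := by linarith
    have h2b : 0 < (2 : ℝ) ^ b := Real.rpow_pos_of_pos (by norm_num) b
    set L : ℝ := C / (8 * (2 : ℝ) ^ b) with hL
    have hL0 : 0 < L := by positivity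
    -- threshold `M` with `M^{2-a} = L`; pick `j` with `x = (1/4)/2^j < M`
    set M : ℝ := L ^ (1 / (2 - a)) with hM
    have hM0 : 0 < M := Real.rpow_pos_of_pos hL0 _
    obtain ⟨j, hj⟩ := exists_pow_lt_of_lt_one (show 0 < 4 * M by positivity) (show (1 / 2 : ℝ) < 1 by norm_num)
    obtain ⟨N, P, hPB, -, hVar, hInf⟩ := exists_averagedAddress 0 j
    set x : ℝ := 1 / 4 / (2 : ℝ) ^ j with hx
    have hx0 : 0 < x := by positivity
    have hxM : x < M := by
      have : (1 / 2 : ℝ) ^ j = 1 / (2 : ℝ) ^ j := by rw [one_div_pow]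
      rw [this] at hj
      have : x = (1 / (2 : ℝ) ^ j) / 4 := by rw [hx]; ring
      rw [this]; linarith
    have hVpos : 0 < boolVariance P := by rw [hVar]; exact hx0
    obtain ⟨i, hi⟩ := h N (2 ^ (0 + 1)) P (by norm_num) hPB hVpos
    rw [hVar, hInf i] at hi
    -- `hi : C x^a / 2^b ≤ 1/2 / 4^j = 8 x²`
    have h8 : 1 / (2 : ℝ) ^ (0 + 1) / (4 : ℝ) ^ j = 8 * x ^ 2 := by
      rw [hx, show (4 : ℝ) ^ j = ((2 : ℝ) ^ j) ^ 2 by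
        rw [← pow_mul, show (4 : ℝ) = 2 ^ 2 by norm_num, ← pow_mul, mul_comm]]
      field_simp
      ring
    have hT : (((2 ^ (0 + 1) : ℕ) : ℝ)) ^ b = (2 : ℝ) ^ b := by norm_num
    rw [h8, hT] at hi
    -- so `L ≤ x^{2-a}`: from `C x^a ≤ 8·2^b·x²` and `x² = x^a · x^{2-a}`
    have hxsplit : x ^ 2 = x ^ a * x ^ (2 - a) := by
      rw [← Real.rpow_add hx0, show a + (2 - a) = (2 : ℝ) by ring]
      exact_mod_cast (Real.rpow_natCast x 2).symm
    have hxa : 0 < x ^ a := Real.rpow_pos_of_pos hx0 a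
    have hle : L ≤ x ^ (2 - a) := by
      rw [hL, div_le_iff₀ (by positivity)]
      rw [div_le_iff₀ h2b, hxsplit] at hi
      -- hi : C * x^a ≤ 8 * (x^a * x^(2-a)) * 2^b
      by_contra hcon
      push Not at hcon
      have : 8 * (x ^ a * x ^ (2 - a)) * (2 : ℝ) ^ b < x ^ a * C := by
        have := mul_lt_mul_of_pos_left hcon (mul_pos hxa h2b)
        nlinarith [this]
      nlinarith
    -- but `x^{2-a} < M^{2-a} = L`
    have hlt2 : x ^ (2 - a) < M ^ (2 - a) := Real.rpow_lt_rpow hx0.le hxM he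
    have hMe : M ^ (2 - a) = L := by
      rw [hM, ← Real.rpow_mul hL0.le, one_div_mul_cancel he.ne', Real.rpow_one]
    linarith [hMe ▸ hlt2]
  · -- `b ≥ 2`: the Chebyshev family
    by_contra hlt
    push Not at hlt
    set v : ℝ := 1 / 2592 with hv
    have hv0 : 0 < v := by norm_num
    set K : ℝ := C * v ^ a with hK
    have hK0 : 0 < K := mul_pos hC (Real.rpow_pos_of_pos hv0 a)
    have he : 0 < 2 - b := by linarith
    set M : ℝ := (29 / K) ^ (1 / (2 - b)) with hM
    have hM0 : 0 ≤ M := Real.rpow_nonneg (by positivity) _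
    obtain ⟨r₀, hr₀⟩ := exists_nat_gt M
    set r := r₀ + 1 with hrdef
    have hr : 1 ≤ r := by omega
    obtain ⟨hpb, hvarP, hinfP⟩ := chebyshev_calibration r hr
    have hk1 : 1 ≤ 4 * (3 * r) := by omega
    obtain ⟨i, hi⟩ := h (144 * r ^ 2) (4 * (3 * r)) _ hk1 hpb (lt_of_lt_of_le hv0 hvarP)
    have hinf := hinfP i
    set V := boolVariance ((Polynomial.aeval (∑ i : Fin (144 * r ^ 2),
          (MvPolynomial.C (1 / ((144 * r ^ 2 : ℕ) : ℝ)) -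
            MvPolynomial.C (2 / ((144 * r ^ 2 : ℕ) : ℝ)) * MvPolynomial.X i))
          (Polynomial.Chebyshev.T ℝ ((4 * (3 * r) : ℕ) : ℤ))) ^ 2) with hV
    set k : ℝ := ((4 * (3 * r) : ℕ) : ℝ) with hkdef
    have hkr : k = 12 * r := by rw [hkdef]; push_cast; ring
    have hr0 : (0 : ℝ) < r := by exact_mod_cast (show 0 < r by omega)
    have hkpos : 0 < k := by rw [hkr]; positivity
    have hkM : M < k := by
      have : (r₀ : ℝ) + 1 = r := by rw [hrdef]; push_cast; ring
      rw [hkr]; nlinarith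
    have hkb : 0 < k ^ b := Real.rpow_pos_of_pos hkpos b
    have hVa : v ^ a ≤ V ^ a := Real.rpow_le_rpow hv0.le hvarP ha
    have h1 : K / k ^ b ≤ 29 / k ^ 2 := by
      calc K / k ^ b ≤ C * V ^ a / k ^ b :=
            div_le_div_of_nonneg_right (mul_le_mul_of_nonneg_left hVa hC.le) hkb.le
        _ ≤ _ := hi
        _ ≤ 29 / k ^ 2 := hinf
    have hsplit : k ^ 2 = k ^ b * k ^ (2 - b) := by
      rw [← Real.rpow_add hkpos, show b + (2 - b) = (2 : ℝ) by ring]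
      exact_mod_cast (Real.rpow_natCast k 2).symm
    have h2 : K * k ^ (2 - b) ≤ 29 := by
      rw [div_le_div_iff₀ hkb (by positivity), hsplit] at h1
      nlinarith [h1, Real.rpow_pos_of_pos hkpos (2 - b)]
    have h3 : M ^ (2 - b) < k ^ (2 - b) := Real.rpow_lt_rpow hM0 hkM he
    have hMe : M ^ (2 - b) = 29 / K := by
      rw [hM, ← Real.rpow_mul (by positivity), one_div_mul_cancel he.ne', Real.rpow_one]
    rw [hMe] at h3
    have h4 : 29 < K * k ^ (2 - b) := by
      have := mul_lt_mul_of_pos_left h3 hK0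
      rwa [mul_div_cancel₀ _ hK0.ne'] at this
    linarith

end Summit.QuantumAdvantage.QuantumAdvantage.Theorems.SosSandwich

end
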